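import Summits.ValiantsHypothesis.ValiantsHypothesis.Theorems.GrenetZeonDualUnipotentThreeHalvesSlowCoreAbsorb
import Summits.ValiantsHypothesis.ValiantsHypothesis.Theorems.GrenetZeonDualUnipotentThreeHalvesSlowCoreDefs
import Summits.ValiantsHypothesis.ValiantsHypothesis.Theorems.GrenetZeonTwoDimCoefficientsDualUnipotentTriangular

/-!
# `GrenetZeon.DualUnipotentThreeHalves` (stmt-ValiantsHypothesis-24318), line `slow_core` REV 2 (THE MASS CUT): LEDGER vocabulary + glue providers

Theorems twins (same bodies, over ✓ `…WordDefs` `RadicalSplit.lineSubst`/`pencilAlg` and ✓ p677282 `SlowCore.Slow`) of the MASS-CUT vocabulary of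
val-idea-26 g5 (`Cruxes/DualUnipotentThreeHalves/MassCut.lean` rev 4 @09b6fd968480, not importable from Theorems; restated in `Lines/slow_core.lean`
rev 2 @707c99ddbabe): `linEntry`, `Freezes`, `Ledger`, `RelCert`, `LevelCut`, `ShortMassLedger0`, `IrreducibleInv`, `LongMassSlowLawInv`; and the
providers of the glue `(b₀) → (c) → S3` (crit-7 g3 V27 (q3) debt (g1)–(g5)): §0 `lineSubst_apply_of_le_one`; §1 `slow_of_relCert`; §2 (g5) CLASS FREEZE
`classBlock`, `pow_apply_eq_classBlock_pow` (class block of a power = power of the class block, level-cut), `ledger_class_of_frozen`; §3 (b₀)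
`shortMassLedger0_holds` (✓ p678690 `absorb_chain_uniform`); §4 (g3) `ledger_top_of_conj`; §5 `levelCut_mono`, `isAffine_conj`; §6 (g1)/(g4) CLASS
PENCILS `classPencil N' e : AffMat n s`, `submatrix_pow_apply_of_levelCut`, `classPencil_pow_eq_zero`, `ledger_class_of_classPencil`,
`irreducibleInv_classPencil` (the block clause of ✓ `HeavyTopCompositionBound.exists_block_conj` IS `IrreducibleInv` of the class pencil); §7
`pow_card_eq_zero_of_pow_eq_zero` (Cayley–Hamilton); §8 definitions for the glue files: `linFun`, `freezeSpace`, `lvlSize`, `lvlCum`, `coarsen`.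

Honest framing.  Helpers (`--supports stmt-ValiantsHypothesis-24318`); nothing here proves (c), the glue, S3, R2ᵖ, the crux 24318, 8062 or `VP ≠ VNP` —
all OPEN / NOT proved.  Definitions are verbatim twins of the line's (credit val-idea-26 g5); no named facts.
-/

-- single-conjunct layout: Sub = Summit, duplicated namespace component intended (the name is mandated)
set_option linter.dupNamespace false
set_option autoImplicit false

noncomputable section

namespace Summit.ValiantsHypothesis.ValiantsHypothesis.Theorems.GrenetZeon.SlowCore

open MvPolynomial Matrix
open scoped BigOperators
open Summit.ValiantsHypothesis.ValiantsHypothesis.Cruxes.TwoDimCoefficients.DimTwoCases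
  (AffMat IsAffine aeval_line_of_totalDegree_le_one totalDegree_aeval_line_le_one)
open Summit.ValiantsHypothesis.ValiantsHypothesis.Theorems.GrenetZeon.RadicalSplit (lineSubst pencilAlg)

/-! ## §0 Pull-back along a line -/

/-- `lineSubst` is the `k = 0 + 1` instance of the line-arrangement pull-back. -/
theorem lineSubst_eq_aeval {σ : Type*} (x v : σ → ℂ) :
    lineSubst x v = aeval fun c => (C (x c) + ∑ t : Fin (0 + 1), C ((fun _ : Fin (0 + 1) => v) t c) * X t :
      MvPolynomial (Fin (0 + 1)) ℂ) := rfl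

/-- Affine entries stay affine along a line. -/
theorem totalDegree_lineSubst_le_one {σ : Type*} [Fintype σ] (x v : σ → ℂ) {g : MvPolynomial σ ℂ}
    (hg : g.totalDegree ≤ 1) : (lineSubst x v g).totalDegree ≤ 1 := by
  rw [lineSubst_eq_aeval]
  exact totalDegree_aeval_line_le_one x (fun _ : Fin (0 + 1) => v) hg

/-- The linear coefficient of the entry `(i, j)` of the pencil along the direction `v`:  `Σ_c v_c · [x_c] N_ij`. [MassCut, val-idea-26 g5] -/
def linEntry {n m : ℕ} (N : AffMat n m) (i j : Fin m) (v : Fin n × Fin n → ℂ) : ℂ :=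
  ∑ c, v c * coeff (Finsupp.single c 1) (N i j)

/-- Pull-back of an affine entry along `x + s v`: `N_ij(x) + linEntry · s`. -/
theorem lineSubst_apply_of_le_one {n m : ℕ} (N : AffMat n m) (hN : IsAffine N) (x v : Fin n × Fin n → ℂ) (i j : Fin m) :
    lineSubst x v (N i j) = C (eval x (N i j)) + C (linEntry N i j v) * X 0 := by
  rw [lineSubst_eq_aeval, aeval_line_of_totalDegree_le_one x (fun _ : Fin (0 + 1) => v) (hN i j)]
  simp [linEntry]

/-! ## §1 The ledger vocabulary (Theorems twins of `MassCut.lean` / `Lines/slow_core.lean` rev 2) -/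

/-- `K` FREEZES the region `R` of the pencil: along every `v ∈ K` the entries in `R` do not move. [MassCut] -/
def Freezes {n m : ℕ} (N : AffMat n m) (R : Fin m → Fin m → Prop) (K : Submodule ℂ (Fin n × Fin n → ℂ)) : Prop :=
  ∀ i j, R i j → ∀ v ∈ K, linEntry N i j v = 0

/-- **LEDGER ENTRY** (window currency): along `K`, every power `b ≤ n − 1` of `N(x + s v)` has `s`-degree `≤ k` on the block `S × S`. [MassCut] -/
def Ledger (n m : ℕ) (N : AffMat n m) (S : Fin m → Prop) (K : Submodule ℂ (Fin n × Fin n → ℂ)) (k : ℕ) : Prop :=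
  ∀ x v : Fin n × Fin n → ℂ, v ∈ K → ∀ b, b ≤ n - 1 → ∀ i j : Fin m, S i → S j →
    (((N.map (lineSubst x v)) ^ b) i j).totalDegree ≤ k

/-- **PRICE** `P` of a whole-pencil certificate: a ledger `(K, k)` on `⊤` with `n·k + codim K ≤ P`. [MassCut] -/
def RelCert (n m : ℕ) (N : AffMat n m) (P : ℕ) : Prop :=
  ∃ (K : Submodule ℂ (Fin n × Fin n → ℂ)) (k : ℕ), Ledger n m N (fun _ => True) K k ∧ n * k + (n * n - Module.finrank ℂ K) ≤ P

/-- LEVEL CUT (orientation of ✓ `SlowCore.pow_apply_eq_zero_of_lvl_lt`): paths only DROP in level. [MassCut] -/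
def LevelCut {n m : ℕ} (N : AffMat n m) (lvl : Fin m → ℕ) : Prop :=
  ∀ i j, lvl i < lvl j → N i j = 0

/-- **(b₀) SHORT-MASS LEDGER, a = 0**: per-level ledgers `kb p` on a COMMON `K` of a level-cut affine pencil stack to `Σ_{p<P} kb p + (P − 1)`. [MassCut] -/
def ShortMassLedger0 : Prop :=
  ∀ (n m P : ℕ) (N : AffMat n m), IsAffine N → ∀ lvl : Fin m → ℕ, (∀ i, lvl i < P) → LevelCut N lvl →
    ∀ (K : Submodule ℂ (Fin n × Fin n → ℂ)) (kb : ℕ → ℕ),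
      (∀ p, p < P → Ledger n m N (fun i => lvl i = p) K (kb p)) →
      Ledger n m N (fun _ => True) K ((∑ p ∈ Finset.range P, kb p) + (P - 1))

/-- Ledgers are monotone in the block, the direction space and the order. [MassCut] -/
theorem ledger_mono {n m : ℕ} {N : AffMat n m} {S S' : Fin m → Prop} {K K' : Submodule ℂ (Fin n × Fin n → ℂ)} {k k' : ℕ}
    (h : Ledger n m N S K k) (hS : ∀ i, S' i → S i) (hK : K' ≤ K) (hk : k ≤ k') : Ledger n m N S' K' k' :=
  fun x v hv b hb i j hi hj => (h x v (hK hv) b hb i j (hS i hi) (hS j hj)).trans hk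

/-- Direction spaces have dimension `≤ n²`. -/
theorem finrank_dir_le (n : ℕ) (K : Submodule ℂ (Fin n × Fin n → ℂ)) : Module.finrank ℂ K ≤ n * n := by
  calc Module.finrank ℂ K ≤ Module.finrank ℂ (Fin n × Fin n → ℂ) := Submodule.finrank_le K
    _ = n * n := by rw [Module.finrank_pi, Fintype.card_prod, Fintype.card_fin]

/-- A whole-pencil ledger `(K, k)` with `(k+1)·n < dim K` is `SlowR`, hence `Slow`. -/
theorem slowR_of_ledger {n m : ℕ} {N : AffMat n m} {K : Submodule ℂ (Fin n × Fin n → ℂ)} {k : ℕ}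
    (h : Ledger n m N (fun _ => True) K k) (hk : (k + 1) * n < Module.finrank ℂ K) : SlowR n m N :=
  ⟨K, k, fun x v hv b hb i j => h x v hv b hb i j trivial trivial, hk⟩

/-- **A certificate of price `P` with `P + n < n²` is a slow plane** (val-idea-26 g5 `slowR_of_relCert`). -/
theorem slow_of_relCert {n m : ℕ} {N : AffMat n m} {P : ℕ} (h : RelCert n m N P) (hP : P + n < n * n) : Slow n m N := by
  obtain ⟨K, k, hK, hcost⟩ := h
  have hle := finrank_dir_le n K
  have hsub : n * n - Module.finrank ℂ K + Module.finrank ℂ K = n * n := Nat.sub_add_cancel hle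
  have hkn : (k + 1) * n = n * k + n := by ring
  exact slow_of_slowR (slowR_of_ledger hK (by rw [hkn]; omega))

/-! ## §2 Class blocks of a level-cut matrix; FREEZE at class level (g5) -/

section ClassBlock
variable {m : ℕ} {R : Type*}

/-- The CLASS BLOCK of level `p`: the matrix `M` with every entry outside `{lvl = p} × {lvl = p}` replaced by `0` (same index type). -/
def classBlock [Zero R] (lvl : Fin m → ℕ) (p : ℕ) (M : Matrix (Fin m) (Fin m) R) : Matrix (Fin m) (Fin m) R :=
  Matrix.of fun i j => if lvl i = p ∧ lvl j = p then M i j else 0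

/-- Entries of the class block. -/
theorem classBlock_apply [Zero R] (lvl : Fin m → ℕ) (p : ℕ) (M : Matrix (Fin m) (Fin m) R) (i j : Fin m) :
    classBlock lvl p M i j = if lvl i = p ∧ lvl j = p then M i j else 0 := rfl

/-- **Class block of a power = power of the class block** (on the class) for a level-cut matrix: paths inside level `p` never leave it. -/
theorem pow_apply_eq_classBlock_pow [CommRing R] (lvl : Fin m → ℕ) (p : ℕ) (M : Matrix (Fin m) (Fin m) R)
    (hbu : ∀ i j, lvl i < lvl j → M i j = 0) :
    ∀ (b : ℕ) (i j : Fin m), lvl i = p → lvl j = p → (M ^ b) i j = ((classBlock lvl p M) ^ b) i j := by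
  intro b
  induction b with
  | zero => intro i j _ _; simp [pow_zero]
  | succ b ih =>
    intro i j hi hj
    rw [pow_succ, pow_succ, Matrix.mul_apply, Matrix.mul_apply]
    refine Finset.sum_congr rfl fun k _ => ?_
    by_cases hk : lvl k = p
    · rw [ih i k hi hk, classBlock_apply, if_pos ⟨hk, hj⟩]
    · have hkj : (classBlock lvl p M) k j = 0 := if_neg (fun h => hk h.1)
      rw [hkj, mul_zero]
      rcases lt_or_gt_of_ne hk with hlt | hgt
      · rw [hbu k j (by omega), mul_zero]
      · rw [pow_apply_eq_zero_of_lvl_lt lvl M hbu b i k (by omega), zero_mul]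

end ClassBlock

/-- Along a direction freezing the block `{lvl = p}²`, the class block of the substituted pencil is a matrix of constants. -/
theorem classBlock_map_lineSubst_of_freezes {n m : ℕ} (N : AffMat n m) (hN : IsAffine N) (lvl : Fin m → ℕ) (p : ℕ)
    {K : Submodule ℂ (Fin n × Fin n → ℂ)} (hK : Freezes N (fun i j => lvl i = p ∧ lvl j = p) K)
    (x v : Fin n × Fin n → ℂ) (hv : v ∈ K) :
    classBlock lvl p (N.map (lineSubst x v)) = (classBlock lvl p (N.map (MvPolynomial.eval x))).map C := by
  refine Matrix.ext fun i j => ?_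
  rw [Matrix.map_apply, classBlock_apply, classBlock_apply, Matrix.map_apply, Matrix.map_apply]
  by_cases h : lvl i = p ∧ lvl j = p
  · rw [if_pos h, if_pos h, lineSubst_apply_of_le_one N hN x v i j, hK i j h v hv]
    simp
  · rw [if_neg h, if_neg h, map_zero]

/-- Entries of powers of a matrix of constants have degree `0`. [MassCut] -/
theorem totalDegree_map_C_pow_apply {m : ℕ} (P : Matrix (Fin m) (Fin m) ℂ) (b : ℕ) (i j : Fin m) :
    (((P.map (C : ℂ → MvPolynomial (Fin 1) ℂ)) ^ b) i j).totalDegree = 0 := by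
  rw [show P.map (C : ℂ → MvPolynomial (Fin 1) ℂ) = (C : ℂ →+* MvPolynomial (Fin 1) ℂ).mapMatrix P from rfl, ← map_pow]
  simp [RingHom.mapMatrix_apply, Matrix.map_apply]

/-- The level cut survives substitution along a line. -/
theorem levelCut_map_lineSubst {n m : ℕ} (N : AffMat n m) {lvl : Fin m → ℕ} (hcut : LevelCut N lvl) (x v : Fin n × Fin n → ℂ) :
    ∀ i j, lvl i < lvl j → (N.map (lineSubst x v)) i j = 0 := by
  intro i j hij
  rw [Matrix.map_apply, hcut i j hij, map_zero]

/-- **CLASS FREEZE (g5).**  If `K` freezes the block `{lvl = p} × {lvl = p}` of a level-cut affine pencil, the class ledger of level `p` is `0`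
along `K` (no codimension beyond the freezing conditions, no degree). -/
theorem ledger_class_of_frozen {n m : ℕ} (N : AffMat n m) (hN : IsAffine N) {lvl : Fin m → ℕ} (hcut : LevelCut N lvl) (p : ℕ)
    {K : Submodule ℂ (Fin n × Fin n → ℂ)} (hK : Freezes N (fun i j => lvl i = p ∧ lvl j = p) K) :
    Ledger n m N (fun i => lvl i = p) K 0 := by
  intro x v hv b _ i j hi hj
  rw [pow_apply_eq_classBlock_pow lvl p _ (levelCut_map_lineSubst N hcut x v) b i j hi hj,
    classBlock_map_lineSubst_of_freezes N hN lvl p hK x v hv, totalDegree_map_C_pow_apply]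

/-- ✓ **(b₀) `ShortMassLedger0` HOLDS** — ✓ `absorb_chain_uniform` applied to `M = N(x + s v)` (cut and affinity survive `lineSubst`). -/
theorem shortMassLedger0_holds : ShortMassLedger0 := by
  intro n m P N hN lvl hP hcut K kb hkb x v hv b hb i j _ _
  have haff : ∀ i j, ((N.map (lineSubst x v)) i j).totalDegree ≤ 1 :=
    fun i j => by rw [Matrix.map_apply]; exact totalDegree_lineSubst_le_one x v (hN i j)
  have hk : ∀ b', b' ≤ n - 1 → ∀ i j, lvl i = lvl j → ((((N.map (lineSubst x v)) ^ b') i j).totalDegree ≤ kb (lvl i)) :=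
    fun b' hb' i j hij => hkb (lvl i) (hP i) x v hv b' hb' i j rfl hij.symm
  exact absorb_chain_uniform lvl _ kb (n - 1) P hP (levelCut_map_lineSubst N hcut x v) haff hk b hb i j

/-! ## §4 Conjugation transport (g3) -/

/-- `lineSubst` fixes matrices of constants. -/
theorem map_C_map_lineSubst {m : ℕ} {σ : Type*} (G : Matrix (Fin m) (Fin m) ℂ) (x v : σ → ℂ) :
    (G.map (C : ℂ → MvPolynomial σ ℂ)).map (lineSubst x v) = G.map C := by
  refine Matrix.ext fun i j => ?_
  rw [Matrix.map_apply, Matrix.map_apply, Matrix.map_apply, MvPolynomial.algHom_C, MvPolynomial.algebraMap_eq]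

/-- **CONJUGATION TRANSPORT (g3).**  If `N' = G·N·G'` (constant `G, G'`, `G'·G = 1`), every whole-pencil ledger of `N'` is one of `N` (same `K, k`):
`N(x+sv)^b = G'·N'(x+sv)^b·G` (✓ `FlagCost.conj_pow_eq`, ✓ `FlagCost.totalDegree_conj_le`). -/
theorem ledger_top_of_conj {n m : ℕ} (N N' : AffMat n m) (G G' : Matrix (Fin m) (Fin m) ℂ) (hGG : G' * G = 1)
    (hN' : N' = G.map C * N * G'.map C) {K : Submodule ℂ (Fin n × Fin n → ℂ)} {k : ℕ}
    (h : Ledger n m N' (fun _ => True) K k) : Ledger n m N (fun _ => True) K k := by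
  intro x v hv b hb i j _ _
  have hGGc : (G'.map (C : ℂ → MvPolynomial (Fin 1) ℂ)) * G.map C = 1 := by
    rw [show G'.map (C : ℂ → MvPolynomial (Fin 1) ℂ) = (C : ℂ →+* MvPolynomial (Fin 1) ℂ).mapMatrix G' from rfl,
      show G.map (C : ℂ → MvPolynomial (Fin 1) ℂ) = (C : ℂ →+* MvPolynomial (Fin 1) ℂ).mapMatrix G from rfl, ← map_mul, hGG, map_one]
  have hsub : N'.map (lineSubst x v) = G.map C * N.map (lineSubst x v) * G'.map C := by
    rw [hN', Matrix.map_mul, Matrix.map_mul, map_C_map_lineSubst, map_C_map_lineSubst]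
  have hconj : (N.map (lineSubst x v)) ^ b = G'.map C * (N'.map (lineSubst x v)) ^ b * G.map C := by
    rw [hsub]
    exact (Summit.ValiantsHypothesis.ValiantsHypothesis.Theorems.GrenetZeon.FlagCost.conj_pow_eq (G.map C) (G'.map C)
      (N.map (lineSubst x v)) hGGc b).symm
  rw [hconj]
  exact Summit.ValiantsHypothesis.ValiantsHypothesis.Theorems.GrenetZeon.FlagCost.totalDegree_conj_le G G'
    ((N'.map (lineSubst x v)) ^ b) (fun a c => h x v hv b hb a c trivial trivial) i j

/-! ## §5 Coarsening the levels -/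

/-- A monotone relabelling of the levels keeps the cut (merged classes are unions of consecutive classes). -/
theorem levelCut_mono {n m : ℕ} {N : AffMat n m} {lvl : Fin m → ℕ} (hcut : LevelCut N lvl) (f : ℕ → ℕ) (hf : Monotone f) :
    LevelCut N (f ∘ lvl) := by
  intro i j hij
  exact hcut i j (lt_of_not_ge fun h => absurd (hf h) (not_le.2 hij))

/-- Conjugating an affine pencil by constants keeps it affine. -/
theorem isAffine_conj {n m : ℕ} (N : AffMat n m) (hN : IsAffine N) (G G' : Matrix (Fin m) (Fin m) ℂ) :
    IsAffine (G.map C * N * G'.map C) := by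
  intro i j
  simp only [Matrix.mul_apply, Matrix.map_apply]
  refine (totalDegree_finsetSum _ _).trans (Finset.sup_le fun b _ => ?_)
  refine (totalDegree_mul _ _).trans ?_
  rw [totalDegree_C, add_zero]
  refine (totalDegree_finsetSum _ _).trans (Finset.sup_le fun c _ => ?_)
  refine (totalDegree_mul _ _).trans ?_
  rw [totalDegree_C, zero_add]
  exact hN c b


/-! ## §6 CLASS PENCILS of a level-cut pencil (glue debt (g1)/(g4)): the diagonal block of level `p`, re-indexed by `Fin s`, as an `AffMat n s` -/

/-- Irreducibility as «no common invariant subspace of the points `B(x)`» (val-idea-26 g5 E27-3 `IrreducibleInv`, verbatim twin): the form in which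
✓ `HeavyTopCompositionBound.exists_block_conj` delivers the diagonal blocks of a composition series; equivalent to `pencilAlg B = ⊤` by Burnside. -/
def IrreducibleInv {n b : ℕ} (B : AffMat n b) : Prop :=
  ∀ V : Submodule ℂ (Fin b → ℂ), (∀ x : Fin n × Fin n → ℂ, ∀ w ∈ V, (B.map (MvPolynomial.eval x)).mulVec w ∈ V) → V = ⊥ ∨ V = ⊤

section ClassPencil
variable {m s : ℕ} {lvl : Fin m → ℕ} {p : ℕ}

/-- The coordinates of level `p`, enumerated by `Fin s` through `e`. -/
def classEmb (e : {i : Fin m // lvl i = p} ≃ Fin s) (a : Fin s) : Fin m := ((e.symm a : {i : Fin m // lvl i = p}) : Fin m)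

/-- The class enumeration is injective. -/
theorem classEmb_injective (e : {i : Fin m // lvl i = p} ≃ Fin s) : Function.Injective (classEmb e) :=
  fun _ _ h => e.symm.injective (Subtype.ext h)

/-- Enumerated coordinates have level `p`. -/
theorem lvl_classEmb (e : {i : Fin m // lvl i = p} ≃ Fin s) (a : Fin s) : lvl (classEmb e a) = p := (e.symm a).2

/-- `classEmb e ∘ e = id` on the class. -/
theorem classEmb_apply_mk (e : {i : Fin m // lvl i = p} ≃ Fin s) (i : Fin m) (hi : lvl i = p) : classEmb e (e ⟨i, hi⟩) = i := by
  simp [classEmb]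

/-- **Powers of the re-indexed class block = class entries of the powers**, for a level-cut matrix over any commutative ring. -/
theorem submatrix_pow_apply_of_levelCut {R : Type*} [CommRing R] (M : Matrix (Fin m) (Fin m) R)
    (hbu : ∀ i j, lvl i < lvl j → M i j = 0) (e : {i : Fin m // lvl i = p} ≃ Fin s) :
    ∀ (b : ℕ) (a c : Fin s), ((M.submatrix (classEmb e) (classEmb e)) ^ b) a c = (M ^ b) (classEmb e a) (classEmb e c) := by
  classical
  intro b
  induction b with
  | zero =>
    intro a c
    simp only [pow_zero, Matrix.one_apply, (classEmb_injective e).eq_iff]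
  | succ b ih =>
    intro a c
    rw [pow_succ, pow_succ, Matrix.mul_apply, Matrix.mul_apply]
    simp only [Matrix.submatrix_apply, ih]
    -- the right-hand sum only sees the class
    symm
    rw [← Finset.sum_image (f := fun k => (M ^ b) (classEmb e a) k * M k (classEmb e c))
      (fun x _ y _ h => classEmb_injective e h)]
    refine (Finset.sum_subset (Finset.subset_univ _) fun k _ hk => ?_).symm
    have hkp : lvl k ≠ p := by
      intro h
      exact hk (Finset.mem_image.2 ⟨e ⟨k, h⟩, Finset.mem_univ _, classEmb_apply_mk e k h⟩)
    have hpc : lvl (classEmb e c) = p := lvl_classEmb e c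
    have hpa : lvl (classEmb e a) = p := lvl_classEmb e a
    rcases lt_or_gt_of_ne hkp with hlt | hgt
    · rw [hbu k _ (by omega), mul_zero]
    · rw [pow_apply_eq_zero_of_lvl_lt lvl M hbu b _ k (by omega), zero_mul]

variable {n : ℕ}

/-- The CLASS PENCIL of level `p` (re-indexed by `Fin s`): an `s × s` affine pencil over the same `n²` coordinates. -/
def classPencil (N' : AffMat n m) (e : {i : Fin m // lvl i = p} ≃ Fin s) : AffMat n s :=
  N'.submatrix (classEmb e) (classEmb e)

/-- The class pencil of an affine pencil is affine. -/
theorem isAffine_classPencil (N' : AffMat n m) (hN' : IsAffine N') (e : {i : Fin m // lvl i = p} ≃ Fin s) :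
    IsAffine (classPencil N' e) :=
  fun _ _ => hN' _ _

/-- `Matrix.map` commutes with taking the class pencil. -/
theorem classPencil_map {S : Type*} (N' : AffMat n m) (e : {i : Fin m // lvl i = p} ≃ Fin s) (φ : MvPolynomial (Fin n × Fin n) ℂ → S) :
    (classPencil N' e).map φ = (N'.map φ).submatrix (classEmb e) (classEmb e) := rfl

/-- **NILPOTENCY DESCENDS**: `N'^m = 0` and the level cut give `(class pencil)^m = 0`. -/
theorem classPencil_pow_eq_zero (N' : AffMat n m) (hcut : LevelCut N' lvl) (e : {i : Fin m // lvl i = p} ≃ Fin s)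
    {h : ℕ} (hnil : N' ^ h = 0) : (classPencil N' e) ^ h = 0 := by
  ext a c
  rw [classPencil, submatrix_pow_apply_of_levelCut N' hcut e h a c, hnil]
  rfl

/-- **(g4) TRANSPORT**: a whole-pencil ledger `(K, k)` of the class pencil is the class ledger `(K, k)` of level `p` of `N'`. -/
theorem ledger_class_of_classPencil (N' : AffMat n m) (hcut : LevelCut N' lvl) (e : {i : Fin m // lvl i = p} ≃ Fin s)
    {K : Submodule ℂ (Fin n × Fin n → ℂ)} {k : ℕ} (h : Ledger n s (classPencil N' e) (fun _ => True) K k) :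
    Ledger n m N' (fun i => lvl i = p) K k := by
  intro x v hv b hb i j hi hj
  have h1 := h x v hv b hb (e ⟨i, hi⟩) (e ⟨j, hj⟩) trivial trivial
  rw [classPencil_map, submatrix_pow_apply_of_levelCut _ (levelCut_map_lineSubst N' hcut x v) e b,
    classEmb_apply_mk, classEmb_apply_mk] at h1
  exact h1

/-- Values of the class pencil of the conjugate `P·N·P⁻¹` are the re-indexed diagonal blocks of the conjugated values. -/
theorem classPencil_conj_map_eval (N : AffMat n m) (P Q : Matrix (Fin m) (Fin m) ℂ) (e : {i : Fin m // lvl i = p} ≃ Fin s)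
    (x : Fin n × Fin n → ℂ) :
    (classPencil (P.map C * N * Q.map C) e).map (MvPolynomial.eval x) =
      Matrix.reindex e e ((P * N.map (MvPolynomial.eval x) * Q).toBlock (fun i => lvl i = p) (fun i => lvl i = p)) := by
  have hval : (P.map C * N * Q.map C).map (MvPolynomial.eval x) = P * N.map (MvPolynomial.eval x) * Q := by
    rw [show ∀ A : AffMat n m, A.map (MvPolynomial.eval x) = (MvPolynomial.eval x).mapMatrix A from fun _ => rfl, map_mul, map_mul]
    simp only [RingHom.mapMatrix_apply]
    congr 1
    · congr 1
      ext i j; simp only [Matrix.map_apply, MvPolynomial.eval_C]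
    · ext i j; simp only [Matrix.map_apply, MvPolynomial.eval_C]
  rw [classPencil_map, hval]
  ext a c
  simp [Matrix.reindex_apply, Matrix.toBlock_apply, classEmb]

/-- **(g1) IRREDUCIBILITY TRANSFER**: the block-irreducibility clause of ✓ `exists_block_conj` (for the set of values of `N`) is `IrreducibleInv` of the
class pencil of the conjugate. -/
theorem irreducibleInv_classPencil (N : AffMat n m) (P Q : Matrix (Fin m) (Fin m) ℂ) (e : {i : Fin m // lvl i = p} ≃ Fin s)
    (hirr : ∀ U : Submodule ℂ (Fin s → ℂ),
      (∀ A ∈ Set.range (fun x : Fin n × Fin n → ℂ => N.map (MvPolynomial.eval x)), ∀ w ∈ U,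
        (Matrix.reindex e e ((P * A * Q).toBlock (fun i => lvl i = p) (fun i => lvl i = p))) *ᵥ w ∈ U) → U = ⊥ ∨ U = ⊤) :
    IrreducibleInv (classPencil (P.map C * N * Q.map C) e) := by
  intro U hU
  refine hirr U fun A hA w hw => ?_
  obtain ⟨x, rfl⟩ := hA
  rw [← classPencil_conj_map_eval N P Q e x]
  exact hU x w hw

end ClassPencil

/-! ## §7 Nilpotent `s × s` matrices over a domain die at the `s`-th power -/

/-- Over a domain, `B^h = 0` for SOME `h` forces `B^s = 0` for an `s × s` matrix (Cayley–Hamilton: the characteristic polynomial of a nilpotent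
matrix over a reduced ring is `X^s`). -/
theorem pow_card_eq_zero_of_pow_eq_zero {R : Type*} [CommRing R] [IsDomain R] {s h : ℕ} (B : Matrix (Fin s) (Fin s) R) (hB : B ^ h = 0) :
    B ^ s = 0 := by
  have hnil : IsNilpotent (B.charpoly - Polynomial.X ^ s) := by
    simpa [Fintype.card_fin] using Matrix.isNilpotent_charpoly_sub_pow_of_isNilpotent ⟨h, hB⟩
  have hchar : B.charpoly = Polynomial.X ^ s := sub_eq_zero.1 hnil.eq_zero
  have hCH := Matrix.aeval_self_charpoly B
  rwa [hchar, map_pow, Polynomial.aeval_X] at hCH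


/-! ## §8 Definitions consumed by the glue files `…SlowCoreCoarsen` / `…SlowCoreGlue` (freezing spaces, level sizes, the coarsening, (c) Inv form) -/

section GlueDefs
variable {n m : ℕ}

/-- The linear part of the entry `(i, j)` as a linear functional on the direction space. -/
def linFun (N : AffMat n m) (i j : Fin m) : (Fin n × Fin n → ℂ) →ₗ[ℂ] ℂ :=
  ∑ c, coeff (Finsupp.single c 1) (N i j) • LinearMap.proj c

/-- The FREEZING SPACE of a set `R` of positions: directions along which no entry in `R` moves. -/
def freezeSpace (N : AffMat n m) (R : Finset (Fin m × Fin m)) : Submodule ℂ (Fin n × Fin n → ℂ) :=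
  LinearMap.ker (LinearMap.pi fun r : R => linFun N r.1.1 r.1.2)

end GlueDefs

section LevelDefs
variable {m : ℕ} (lvl : Fin m → ℕ)

/-- Size of level `t`. -/
def lvlSize (t : ℕ) : ℕ := (Finset.univ.filter fun i : Fin m => lvl i = t).card

/-- Cumulative size below level `t`. -/
def lvlCum (t : ℕ) : ℕ := (Finset.univ.filter fun i : Fin m => lvl i < t).card

/-- The COARSENING with threshold `T`: level `t` goes to merged class `2·⌊cum t / T⌋ (+1 if level t is big)`.  Merged classes are: single BIG levels
(odd classes) and runs of consecutive SMALL levels starting in the same window of cumulative size (even classes, total size `< 2T`). -/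
def coarsen (T t : ℕ) : ℕ := 2 * (lvlCum lvl t / T) + if T ≤ lvlSize lvl t then 1 else 0

end LevelDefs

/-- **(c) in invariant-subspace form** (val-idea-26 g5 E27-3 `LongMassSlowLawInv`, verbatim twin): every `IrreducibleInv` nilpotent affine `b × b` pencil
over the `n²` coordinates has a certificate of PRICE `≤ c·√n·b`.  RESEARCH statement of line `slow_core` rev 2 (equivalent on paper to the
`pencilAlg = ⊤` form `LongMassSlowLaw` by Burnside); NOT proved anywhere. -/
def LongMassSlowLawInv : Prop :=
  ∃ c n₀ : ℕ, ∀ n ≥ n₀, ∀ b : ℕ, ∀ B : AffMat n b, IsAffine B → B ^ b = 0 → IrreducibleInv B →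
    RelCert n b B (c * (Nat.sqrt n * b))

end Summit.ValiantsHypothesis.ValiantsHypothesis.Theorems.GrenetZeon.SlowCore
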